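import Summits.QuantumFields.YangMills.Theorems.FluctuationComparisonRegPrIntLS2BetaFaceLadderDiscrepancy
import Summits.QuantumFields.YangMills.Theorems.FluctuationComparisonRegPrIntLS2BetaInterBlockFace
import HarnessLib

/-!
# S2β · Q11i — THE FACE DISCREPANCY LETTER OF THE ONE-PROFILE ROW, TOWER EDITION: every face-crossing bond's `R⁻¹η` is the CENTRAL one plus the face ladder
# (`dist1` for any `GaugeGroup`, arc for `SU(2)`; any averaging family, abstract `lift g g₀` under (T4)) — the `hface` of ✓p833084 modulo px20's central letter

Cell `ym3-torus` (rung R3 = continuum `SU(2)` YM₃ on T³ at fixed lattice data — NOT d = 4, NOT infinite volume, NOT a mass gap, NOT Clay).  Width seat `ym3-torus-px5` (gen 23);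
crux `stmt-QuantumFields-20520`, LINE g18-1 S2β; the one-profile LIFT-LADDER″ row (architect 19:24:49Z (i)(ii), 19:37:59Z (1)–(3)).  ✓p833084 `sq_pi_norm_trunc_le_perBlock` takes
`hface : ∀ b ∈ pS, blockOf (b.src + b.dir) ≠ blockOf b.src → ‖logVec (su2Quat (R_b⁻¹·η_b))‖ ≤ sF`.  THIS FILE produces it from TWO named inputs: px20 g24's CENTRAL letter
(⧗`…CentralFaceDiscrepancy.dist1_centralDisc_le_stage`: `dist1 (R⁻¹η)` at the face centre — a hypothesis `hC` here, in `dist1` currency, for the centre `x₀(B,μ) := emb B + ((L−1)∕2)·e_μ`) and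
the relative-plaquette sup `ρ̃` of the pair `(W_t, W̃ := A_W·A_U⁻¹·U_t)` (px12 g26 (d)), via the FACE LADDER ✓p833618 instantiated at that pair ((T4) ⇒ tree-comb agreement in `B` and in
`B + e_μ`, ✓p832282 `tilde_agree_of_treeComb`) and Q11f ✓p832614's reading change `R⁻¹η = u·ε·u⁻¹`: **`‖logVec (su2Quat (R_b⁻¹·η_b))‖ ≤ (π∕2)·(sC + ((d−1)·((L−1)∕2))·(1 + 2·((L−1)∕2))·ρ̃)`**
for every face-crossing `b` whose block and neighbour block are `ρ̃`-controlled.  `--kind proof --supports stmt-QuantumFields-20520 --as helper`, count-neutral, DEFINITION-FREE (0 `def`,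
0 `instance`, 0 `notation`, 0 `sorry`, default heartbeats); generic `P : Params` (standing range), ANY `av`, abstract `lift g g₀` under (T4) `hT4`∕`hT4'`.

WHAT IS PROVED (sorry-free).
* §1 ★★★`dist1_faceDisc_le_of_stage` (any `GaugeGroup`): `dist1 (R_x⁻¹·η_x) ≤ dist1 (R_{x₀}⁻¹·η_{x₀}) + (Σ_{ν≠μ}|(x − emb B)_ν|)·(1 + 2·((L−1)∕2))·ρ̃` for `x ∈ B` on the `μ`-face layer.
* §2 ★`sum_transverse_le` (`Σ_{ν≠μ}|(x − emb B)_ν| ≤ (d−1)·((L−1)∕2)`), ★★★`norm_logVec_faceDisc_le_of_stage` (`SU(2)` arc, crude count) and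
  ★★★`hface_of_central` — the `hface` binder of ✓p833084 VERBATIM from `hC` (central, `dist1`) and `hρ̃` (blocks of `pS` and their `μ`-neighbours), `sF := (π∕2)·(sC + ((d−1)·((L−1)∕2))·(1 + 2·((L−1)∕2))·ρ̃)`.

HONEST SCOPE.  Bookkeeping over landed lemmas; nothing of Bałaban's analysis is asserted or proved; the central letter `hC` (px20), `ρ̃`'s bound (px12 (d)), the tower re-indexing and budgets
are NOT here; rows∕letters HYPOTHESES; GAP♯∘ (`stub_uniformFibreGapOrbit`, registry 3732b7df UNTOUCHED, 0∕5), S2β, the five registered stubs, 20520, 19936, 19200, `YM3TorusSU2` NOT proved;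
no summit statement is proved by a helper; rung R3 — NOT d = 4, NOT infinite volume, NOT a mass gap, NOT Clay; the Yang–Mills mass gap is NOT proved.

References: T. Bałaban, CMP **109** (1987) 249–301 [Balaban1987RG1] ((0.3)–(0.4) p.252); CMP **102** (1985) 277–309 [Balaban1985RegularSpaces] ((1.19) p.79); CMP **122** (1989) 355–392
[Balaban1989LargeFieldII] (p.382).
-/

set_option autoImplicit false

namespace Summit.QuantumFields.YangMills.Theorems.FluctuationComparisonRegPrIntLS2BetaFaceDiscrepancyStage

open scoped Real
open Literature.MathematicalPhysics.QuantumLattice (su2Quat)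
open Literature.MathematicalPhysics.QuantumFieldTheory.Balaban1983to89
open Literature.MathematicalPhysics.QuantumFieldTheory.Balaban1983to89.T4Continuum
open Literature.MathematicalPhysics.QuantumFieldTheory.Balaban1983to89.BlockAveraging
open B10Eq27TorusAxialLog (rel transl axialT)
open T4CubeChartGnomonic (SU2)
open T4ExpWindowSmallField (logVec)
open Summit.QuantumFields.YangMills.Theorems.FluctuationComparisonRegPrIntLS2BetaEtaFactorisation (tilde_agree_of_treeComb)
open Summit.QuantumFields.YangMills.Theorems.FluctuationComparisonRegPrIntLS2BetaDiscrepancyIntraBlock (dist1_disc_eq_dist1_eps)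
open Summit.QuantumFields.YangMills.Theorems.FluctuationComparisonRegPrIntLS2BetaFaceLadderDiscrepancy (dist1_faceChord_le_central_add)
open Summit.QuantumFields.YangMills.Theorems.FluctuationComparisonRegPrIntLS2BetaDistributedHolonomySU2 (norm_logVec_le_pi_div_two_mul_dist1)
open Summit.QuantumFields.YangMills.Theorems.FluctuationComparisonRegPrIntLS2BetaIterAxialGaugeOneLevel (natAbs_rel_emb_le)
open Summit.QuantumFields.YangMills.Theorems.FluctuationComparisonRegPrIntLS2BetaInterBlockFace (rel_emb_eq_half_of_cross)

variable {P : Params} {G : Type*} [GaugeGroup G]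

/-! ## §1 The `dist1` face discrepancy letter at the tower -/

/-- ★★★ **FACE DISCREPANCY = CENTRAL + FACE LADDER (tower, `dist1`)**: with `W_t = g j • iter j U`, `U_t = g₀ j • iter j U₁`, `A_W`, `A_U` their lifts under (T4), `R_x := A_W⟨x,μ⟩·A_U⟨x,μ⟩⁻¹`,
`η_x := W_t⟨x,μ⟩·U_t⟨x,μ⟩⁻¹` and `ρ̃` bounding the relative plaquettes of `(W_t, A_W·A_U⁻¹·U_t)` with source in `B` or `B + e_μ`: for `x ∈ B` with `(x − emb B)_μ = (L−1)∕2`,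
`dist1 (R_x⁻¹·η_x) ≤ dist1 (R_{x₀}⁻¹·η_{x₀}) + (Σ_{ν≠μ}|(x − emb B)_ν|)·(1 + 2·((L−1)∕2))·ρ̃`. [cite: Balaban1987RG1, (0.3)-(0.4) p.252; Balaban1989LargeFieldII, p.382] -/
theorem dist1_faceDisc_le_of_stage (av : ∀ i, Averaging P i G) {j : ℕ} (hj : j + 1 ≤ P.m + P.K)
    (lift : (i : ℕ) → GaugeField P (i + 1) G → GaugeField P i G) (g g₀ : (i : ℕ) → Site P i → G) (U U₁ : GaugeField P 0 G)
    (hT4 : ∀ x, axialT (GaugeField.gaugeAct (g j) (Averaging.iter av j U)) (emb (blockOf x)) x =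
      axialT (lift j (GaugeField.gaugeAct (g (j + 1)) (Averaging.iter av (j + 1) U))) (emb (blockOf x)) x)
    (hT4' : ∀ x, axialT (GaugeField.gaugeAct (g₀ j) (Averaging.iter av j U₁)) (emb (blockOf x)) x =
      axialT (lift j (GaugeField.gaugeAct (g₀ (j + 1)) (Averaging.iter av (j + 1) U₁))) (emb (blockOf x)) x)
    (B : Site P (j + 1)) (μ : Fin P.d) {ρt : ℝ} (hρ0 : 0 ≤ ρt)
    (hρ : ∀ q : Plaq P j, (blockOf q.src = B ∨ blockOf q.src = B.shift μ) →
      dist1 ((GaugeField.plaqHol (fun b => lift j (GaugeField.gaugeAct (g (j + 1)) (Averaging.iter av (j + 1) U)) b *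
            (lift j (GaugeField.gaugeAct (g₀ (j + 1)) (Averaging.iter av (j + 1) U₁)) b)⁻¹ *
          GaugeField.gaugeAct (g₀ j) (Averaging.iter av j U₁) b : GaugeField P j G) q)⁻¹ *
        GaugeField.plaqHol (GaugeField.gaugeAct (g j) (Averaging.iter av j U)) q) ≤ ρt)
    (x : Site P j) (hx : blockOf x = B) (hxface : rel (emb B) x μ = (((P.L - 1) / 2 : ℕ) : ℤ)) :
    dist1 ((lift j (GaugeField.gaugeAct (g (j + 1)) (Averaging.iter av (j + 1) U)) ⟨x, μ⟩ *
            (lift j (GaugeField.gaugeAct (g₀ (j + 1)) (Averaging.iter av (j + 1) U₁)) ⟨x, μ⟩)⁻¹)⁻¹ *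
        (GaugeField.gaugeAct (g j) (Averaging.iter av j U) ⟨x, μ⟩ * (GaugeField.gaugeAct (g₀ j) (Averaging.iter av j U₁) ⟨x, μ⟩)⁻¹)) ≤
      dist1 ((lift j (GaugeField.gaugeAct (g (j + 1)) (Averaging.iter av (j + 1) U)) ⟨transl (emb B) (fun ν => if ν = μ then (((P.L - 1) / 2 : ℕ) : ℤ) else 0), μ⟩ *
            (lift j (GaugeField.gaugeAct (g₀ (j + 1)) (Averaging.iter av (j + 1) U₁)) ⟨transl (emb B) (fun ν => if ν = μ then (((P.L - 1) / 2 : ℕ) : ℤ) else 0), μ⟩)⁻¹)⁻¹ *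
        (GaugeField.gaugeAct (g j) (Averaging.iter av j U) ⟨transl (emb B) (fun ν => if ν = μ then (((P.L - 1) / 2 : ℕ) : ℤ) else 0), μ⟩ *
          (GaugeField.gaugeAct (g₀ j) (Averaging.iter av j U₁) ⟨transl (emb B) (fun ν => if ν = μ then (((P.L - 1) / 2 : ℕ) : ℤ) else 0), μ⟩)⁻¹)) +
      (∑ ν ∈ Finset.univ.filter (fun ν => ν ≠ μ), (rel (emb B) x ν).natAbs) * ((1 + 2 * (((P.L - 1) / 2 : ℕ) : ℝ)) * ρt) := by
  rw [dist1_disc_eq_dist1_eps, dist1_disc_eq_dist1_eps]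
  exact dist1_faceChord_le_central_add hj _ _ B μ
    (tilde_agree_of_treeComb av hj lift g g₀ U U₁ hT4 hT4' B) (tilde_agree_of_treeComb av hj lift g g₀ U U₁ hT4 hT4' (B.shift μ))
    hρ0 (fun q hq => hρ q (Or.inl hq)) (fun q hq => hρ q (Or.inr hq)) x hx hxface

/-! ## §2 The arc letter and the `hface` binder -/

/-- ★ The transverse count: `Σ_{ν≠μ}|(x − emb B)_ν| ≤ (d−1)·((L−1)∕2)` for `x ∈ B`. [cite: Balaban1987RG1, (0.3) p.252] -/
theorem sum_transverse_le {j : ℕ} (hj : j + 1 ≤ P.m + P.K) {B : Site P (j + 1)} {x : Site P j} (hx : blockOf x = B) (μ : Fin P.d) :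
    (∑ ν ∈ Finset.univ.filter (fun ν => ν ≠ μ), (rel (emb B) x ν).natAbs) ≤ (P.d - 1) * ((P.L - 1) / 2) := by
  have hcount : (Finset.univ.filter (fun ν : Fin P.d => ν ≠ μ)).card = P.d - 1 := by
    rw [Finset.filter_ne' Finset.univ μ, Finset.card_erase_of_mem (Finset.mem_univ μ), Finset.card_univ, Fintype.card_fin]
  calc (∑ ν ∈ Finset.univ.filter (fun ν => ν ≠ μ), (rel (emb B) x ν).natAbs)
      ≤ ∑ _ν ∈ Finset.univ.filter (fun ν => ν ≠ μ), (P.L - 1) / 2 := Finset.sum_le_sum (fun ν _ => natAbs_rel_emb_le hj hx ν)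
    _ = (P.d - 1) * ((P.L - 1) / 2) := by rw [Finset.sum_const, hcount, smul_eq_mul]

/-- ★★★ **FACE DISCREPANCY, `SU(2)` ARC, CRUDE COUNT**: in the setting of §1 on `SU(2)`,
`‖logVec (su2Quat (R_x⁻¹·η_x))‖ ≤ (π∕2)·(dist1 (R_{x₀}⁻¹·η_{x₀}) + ((d−1)·((L−1)∕2))·(1 + 2·((L−1)∕2))·ρ̃)`. [cite: Balaban1987RG1, (0.3)-(0.4) p.252; Balaban1989LargeFieldII, p.382] -/
theorem norm_logVec_faceDisc_le_of_stage (av : ∀ i, Averaging P i SU2) {j : ℕ} (hj : j + 1 ≤ P.m + P.K)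
    (lift : (i : ℕ) → GaugeField P (i + 1) SU2 → GaugeField P i SU2) (g g₀ : (i : ℕ) → Site P i → SU2) (U U₁ : GaugeField P 0 SU2)
    (hT4 : ∀ x, axialT (GaugeField.gaugeAct (g j) (Averaging.iter av j U)) (emb (blockOf x)) x =
      axialT (lift j (GaugeField.gaugeAct (g (j + 1)) (Averaging.iter av (j + 1) U))) (emb (blockOf x)) x)
    (hT4' : ∀ x, axialT (GaugeField.gaugeAct (g₀ j) (Averaging.iter av j U₁)) (emb (blockOf x)) x =
      axialT (lift j (GaugeField.gaugeAct (g₀ (j + 1)) (Averaging.iter av (j + 1) U₁))) (emb (blockOf x)) x)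
    (B : Site P (j + 1)) (μ : Fin P.d) {ρt : ℝ} (hρ0 : 0 ≤ ρt)
    (hρ : ∀ q : Plaq P j, (blockOf q.src = B ∨ blockOf q.src = B.shift μ) →
      dist1 ((GaugeField.plaqHol (fun b => lift j (GaugeField.gaugeAct (g (j + 1)) (Averaging.iter av (j + 1) U)) b *
            (lift j (GaugeField.gaugeAct (g₀ (j + 1)) (Averaging.iter av (j + 1) U₁)) b)⁻¹ *
          GaugeField.gaugeAct (g₀ j) (Averaging.iter av j U₁) b : GaugeField P j SU2) q)⁻¹ *
        GaugeField.plaqHol (GaugeField.gaugeAct (g j) (Averaging.iter av j U)) q) ≤ ρt)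
    {sC : ℝ}
    (hC : dist1 ((lift j (GaugeField.gaugeAct (g (j + 1)) (Averaging.iter av (j + 1) U)) ⟨transl (emb B) (fun ν => if ν = μ then (((P.L - 1) / 2 : ℕ) : ℤ) else 0), μ⟩ *
            (lift j (GaugeField.gaugeAct (g₀ (j + 1)) (Averaging.iter av (j + 1) U₁)) ⟨transl (emb B) (fun ν => if ν = μ then (((P.L - 1) / 2 : ℕ) : ℤ) else 0), μ⟩)⁻¹)⁻¹ *
        (GaugeField.gaugeAct (g j) (Averaging.iter av j U) ⟨transl (emb B) (fun ν => if ν = μ then (((P.L - 1) / 2 : ℕ) : ℤ) else 0), μ⟩ *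
          (GaugeField.gaugeAct (g₀ j) (Averaging.iter av j U₁) ⟨transl (emb B) (fun ν => if ν = μ then (((P.L - 1) / 2 : ℕ) : ℤ) else 0), μ⟩)⁻¹)) ≤ sC)
    (x : Site P j) (hx : blockOf x = B) (hxface : rel (emb B) x μ = (((P.L - 1) / 2 : ℕ) : ℤ)) :
    ‖logVec (su2Quat ((lift j (GaugeField.gaugeAct (g (j + 1)) (Averaging.iter av (j + 1) U)) ⟨x, μ⟩ *
            (lift j (GaugeField.gaugeAct (g₀ (j + 1)) (Averaging.iter av (j + 1) U₁)) ⟨x, μ⟩)⁻¹)⁻¹ *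
        (GaugeField.gaugeAct (g j) (Averaging.iter av j U) ⟨x, μ⟩ * (GaugeField.gaugeAct (g₀ j) (Averaging.iter av j U₁) ⟨x, μ⟩)⁻¹)))‖ ≤
      π / 2 * (sC + (((P.d - 1) * ((P.L - 1) / 2) : ℕ) : ℝ) * ((1 + 2 * (((P.L - 1) / 2 : ℕ) : ℝ)) * ρt)) := by
  refine (norm_logVec_le_pi_div_two_mul_dist1 _).trans (mul_le_mul_of_nonneg_left ?_ (by positivity))
  refine (dist1_faceDisc_le_of_stage av hj lift g g₀ U U₁ hT4 hT4' B μ hρ0 hρ x hx hxface).trans (add_le_add hC ?_)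
  refine mul_le_mul_of_nonneg_right ?_ (by positivity)
  exact_mod_cast sum_transverse_le hj hx μ

/-- ★★★ **THE `hface` BINDER OF ✓p833084 FROM THE CENTRAL LETTER AND `ρ̃`**: if for every `pS`-bond `b` that crosses a face the CENTRAL discrepancy of that face (block `blockOf b.src`,
direction `b.dir`) has `dist1 ≤ sC` and the relative plaquettes of `(W_t, W̃)` with source in `blockOf b.src` or its `b.dir`-neighbour are `≤ ρ̃`, then
`‖logVec (su2Quat (R_b⁻¹·η_b))‖ ≤ (π∕2)·(sC + ((d−1)·((L−1)∕2))·(1 + 2·((L−1)∕2))·ρ̃)` for every face-crossing `pS`-bond — the `hface` hypothesis of ✓`sq_pi_norm_trunc_le_perBlock` VERBATIM.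
[cite: Balaban1987RG1, (0.3)-(0.4) p.252; Balaban1989LargeFieldII, p.382] -/
theorem hface_of_central (av : ∀ i, Averaging P i SU2) {j : ℕ} (hj : j + 1 ≤ P.m + P.K)
    (lift : (i : ℕ) → GaugeField P (i + 1) SU2 → GaugeField P i SU2) (g g₀ : (i : ℕ) → Site P i → SU2) (U U₁ : GaugeField P 0 SU2)
    (hT4 : ∀ x, axialT (GaugeField.gaugeAct (g j) (Averaging.iter av j U)) (emb (blockOf x)) x =
      axialT (lift j (GaugeField.gaugeAct (g (j + 1)) (Averaging.iter av (j + 1) U))) (emb (blockOf x)) x)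
    (hT4' : ∀ x, axialT (GaugeField.gaugeAct (g₀ j) (Averaging.iter av j U₁)) (emb (blockOf x)) x =
      axialT (lift j (GaugeField.gaugeAct (g₀ (j + 1)) (Averaging.iter av (j + 1) U₁))) (emb (blockOf x)) x)
    (pS : PBond P j → Prop) {ρt : ℝ} (hρ0 : 0 ≤ ρt)
    (hρ : ∀ (b : PBond P j), pS b → ∀ q : Plaq P j, (blockOf q.src = blockOf b.src ∨ blockOf q.src = (blockOf b.src).shift b.dir) →
      dist1 ((GaugeField.plaqHol (fun b => lift j (GaugeField.gaugeAct (g (j + 1)) (Averaging.iter av (j + 1) U)) b *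
            (lift j (GaugeField.gaugeAct (g₀ (j + 1)) (Averaging.iter av (j + 1) U₁)) b)⁻¹ *
          GaugeField.gaugeAct (g₀ j) (Averaging.iter av j U₁) b : GaugeField P j SU2) q)⁻¹ *
        GaugeField.plaqHol (GaugeField.gaugeAct (g j) (Averaging.iter av j U)) q) ≤ ρt)
    {sC : ℝ}
    (hC : ∀ (b : PBond P j), pS b → blockOf (b.src.shift b.dir) ≠ blockOf b.src →
      dist1 ((lift j (GaugeField.gaugeAct (g (j + 1)) (Averaging.iter av (j + 1) U))
              ⟨transl (emb (blockOf b.src)) (fun ν => if ν = b.dir then (((P.L - 1) / 2 : ℕ) : ℤ) else 0), b.dir⟩ *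
            (lift j (GaugeField.gaugeAct (g₀ (j + 1)) (Averaging.iter av (j + 1) U₁))
              ⟨transl (emb (blockOf b.src)) (fun ν => if ν = b.dir then (((P.L - 1) / 2 : ℕ) : ℤ) else 0), b.dir⟩)⁻¹)⁻¹ *
        (GaugeField.gaugeAct (g j) (Averaging.iter av j U) ⟨transl (emb (blockOf b.src)) (fun ν => if ν = b.dir then (((P.L - 1) / 2 : ℕ) : ℤ) else 0), b.dir⟩ *
          (GaugeField.gaugeAct (g₀ j) (Averaging.iter av j U₁)
            ⟨transl (emb (blockOf b.src)) (fun ν => if ν = b.dir then (((P.L - 1) / 2 : ℕ) : ℤ) else 0), b.dir⟩)⁻¹)) ≤ sC) :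
    ∀ b : PBond P j, pS b → blockOf (b.src.shift b.dir) ≠ blockOf b.src →
      ‖logVec (su2Quat ((lift j (GaugeField.gaugeAct (g (j + 1)) (Averaging.iter av (j + 1) U)) b *
          (lift j (GaugeField.gaugeAct (g₀ (j + 1)) (Averaging.iter av (j + 1) U₁)) b)⁻¹)⁻¹ *
        (GaugeField.gaugeAct (g j) (Averaging.iter av j U) b * (GaugeField.gaugeAct (g₀ j) (Averaging.iter av j U₁) b)⁻¹)))‖ ≤
        π / 2 * (sC + (((P.d - 1) * ((P.L - 1) / 2) : ℕ) : ℝ) * ((1 + 2 * (((P.L - 1) / 2 : ℕ) : ℝ)) * ρt)) := by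
  intro b hb hcross
  obtain ⟨x, μ⟩ := b
  have hxface : rel (emb (blockOf x)) x μ = (((P.L - 1) / 2 : ℕ) : ℤ) := rel_emb_eq_half_of_cross hj rfl hcross
  exact norm_logVec_faceDisc_le_of_stage av hj lift g g₀ U U₁ hT4 hT4' (blockOf x) μ hρ0 (hρ ⟨x, μ⟩ hb) (hC ⟨x, μ⟩ hb hcross) x rfl hxface

end Summit.QuantumFields.YangMills.Theorems.FluctuationComparisonRegPrIntLS2BetaFaceDiscrepancyStage
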